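import Literature.Analysis.FluidPDE.PeriodicCylinderNeumannWallWords
import Literature.Analysis.FluidPDE.PeriodicCylinderInteriorWords
import Literature.Analysis.FluidPDE.Ferrari1993PressureEstimateData
import HarnessLib

/-!
# Ferrari (1993), Lemma 2: the pressure estimate on the periodic cylinder — discharge

Topic `Literature/Analysis/FluidPDE`. This file proves the named fact
`Literature.Analysis.FluidPDE.Ferrari1993_periodicCylinderPressureEstimate` (A. B. Ferrari, *On the
blow-up of solutions of the 3-D Euler equations in a bounded domain*, Comm. Math. Phys. **155**
(1993), Lemma 2, pp. 280–281), in the concrete periodic-cylinder model of the tree: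

  `‖∇p(t)‖_{H³(cell)} ≤ C ‖u(t)‖_{W^{1,∞}(cell)} ‖u(t)‖_{H³(cell)}`.

Ferrari's proof: `p` solves the Neumann problem (10)–(12),
`Δp = −tr(∇u ∇u)` in `Ω`, `∂p/∂n = Σᵢⱼ uᵢuⱼ ∂ᵢnⱼ` on `∂Ω`, and "the standard estimate
`‖∇p‖_{H^s} ≤ C(‖Δp‖_{H^{s−1}} + ‖∂p/∂n‖_{H^{s−1/2}(∂Ω)})`" (Temam 1975; Lions–Magenes) combined with
Moser-type product estimates gives the bound. The reduction to the standard Neumann estimate — with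
the boundary datum extended to the solid as `G = u₀² + u₁²`, so that the trace norm is dominated by
`‖G‖_{H³(cell)}` — is `Ferrari1993_periodicCylinderPressureEstimate_of_neumannEstimate`
(`Ferrari1993PressureEstimateReduction.lean`). The present file supplies the **standard Neumann
estimate on the period cell** (`periodicCylinder_neumannEstimate`):

  `‖∇q‖_{H³(cell)} ≤ C (‖Δq‖_{H²(cell)} + ‖G‖_{H³(cell)})`

for `q, G` smooth on the closed cylinder, `L`-periodic, with `∂q/∂n = G` on the wall, assembled
from the proved pieces of the tree: the base estimate (`PeriodicCylinderNeumannGradient`), the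
tangential estimates (`PeriodicCylinderNeumannTangential`), the normal derivatives from the equation
(`PeriodicCylinderNeumannFrameWords`), the frame inversion near the wall
(`PeriodicCylinderFrameInversion`, `PeriodicCylinderNeumannWallWords`), the interior `H²`-regularity
(`PeriodicCylinderInteriorWords`), and the conversions between word sums and the tree's Sobolev norms
(`PeriodicCylinderWordNorms`, `Ferrari1993PressureEstimateData`).

Mathlib/tree search: no Neumann `H^s` estimate existed in the tree before this line of files
(`lean search 'neumann'`); the statement proved is the hypothesis `hN` of the landed reduction,
verbatim.
-/

noncomputable section

open MeasureTheory Set Function Filter Topology TopologicalSpace WithLp Metric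
open scoped ContDiff NNReal ENNReal InnerProductSpace RealInnerProductSpace Laplacian

namespace Literature.Analysis.FluidPDE

open Literature.Analysis.FunctionSpaces

/-- Local notation for physical space `ℝ³ = EuclideanSpace ℝ (Fin 3)`. -/
local notation "ℝ³" => EuclideanSpace ℝ (Fin 3)

/-- Local notation for the closed unit cylinder `{r ≤ 1}`. -/
local notation "𝕂" => closure (SetLike.coe unitCylinder : Set (EuclideanSpace ℝ (Fin 3)))

/-! ### One more innermost letter on a basis word -/

/-- The basis word of `w` applied to `∂ᵢ q` is the constant word of the list
`(ofFn (e∘w)).reverse ++ [eᵢ]` applied to `q`. [folklore] -/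
theorem cylWord_constWord_cylDeriv_eq_constFields {m : ℕ} (w : Fin m → Fin (Module.finrank ℝ ℝ³)) (a : ℝ³)
    (q : ℝ³ → ℝ) :
    cylWord (jcWord (constWord fun j => Module.finBasis ℝ ℝ³ (w j))) (cylDeriv (fun _ => a) q) =
      cylWord (constFields ((List.ofFn fun j => Module.finBasis ℝ ℝ³ (w j)).reverse ++ [a])) q := by
  rw [constFields_eq_jcWord, List.map_append, jcWord_append, cylWord_append]
  rfl

/-- The letters of that list have norm at most `max‖e_k‖ ∨ ‖a‖`. [folklore] -/
theorem norm_le_of_mem_basisList {m : ℕ} (w : Fin m → Fin (Module.finrank ℝ ℝ³)) (a : ℝ³) {M : ℝ}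
    (hMb : ∀ k, ‖Module.finBasis ℝ ℝ³ k‖ ≤ M) (ha : ‖a‖ ≤ M) {v : ℝ³}
    (hv : v ∈ (List.ofFn fun j => Module.finBasis ℝ ℝ³ (w j)).reverse ++ [a]) : ‖v‖ ≤ M := by
  rcases List.mem_append.1 hv with h | h
  · obtain ⟨j, rfl⟩ := List.mem_ofFn.1 (List.mem_reverse.1 h)
    exact hMb _
  · rw [List.mem_singleton.1 h]; exact ha

/-! ### The standard Neumann estimate on the period cell, real form -/

/-- **The standard Neumann estimate on the period cell, in word sums.** For `L > 0` there is `C`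
such that for all `q`, `G` smooth on the closed cylinder, `L`-periodic, with `x_h·∇q = G` on the wall,
`𝒩₃(∇_K q) ≤ C (𝒩₂(Δ_K q) + 𝒩₃(G))`. Proof: every basis word of `∇_K q` is a sum of constant words
of `q` of length `1, …, 4`; each splits into its size on `{r < 1/2}` (interior `H²`-regularity) and on
`{r ≥ 1/2}` (frame inversion, normal form, frame-word estimate); the data and `‖∇q‖` are then bounded
by the word sums. [folklore] -/
theorem exists_wordSum_cylGrad_le_of_neumann {L : ℝ} (hL : 0 < L) :
    ∃ C : ℝ, 0 ≤ C ∧ ∀ (q G : ℝ³ → ℝ), ContDiffOn ℝ ∞ q 𝕂 → ContDiffOn ℝ ∞ G 𝕂 →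
      IsAxiallyPeriodic L q → IsAxiallyPeriodic L G →
      (∀ x ∈ frontier (unitCylinder : Set ℝ³), cylDeriv (fun y => horizontalProj y) q x = G x) →
      (∑ k ∈ Finset.range 4, ∑ w : Fin k → Fin (Module.finrank ℝ ℝ³),
          cellL2 L (cylWord (jcWord (constWord fun j => Module.finBasis ℝ ℝ³ (w j))) (cylGrad q))) ≤
        C * ((∑ k ∈ Finset.range 3, ∑ w : Fin k → Fin (Module.finrank ℝ ℝ³),
            cellL2 L (cylWord (jcWord (constWord fun j => Module.finBasis ℝ ℝ³ (w j))) (cylLap q))) +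
          ∑ k ∈ Finset.range 4, ∑ w : Fin k → Fin (Module.finrank ℝ ℝ³),
            cellL2 L (cylWord (jcWord (constWord fun j => Module.finBasis ℝ ℝ³ (w j))) G)) := by
  set b := Module.finBasis ℝ ℝ³ with hb
  -- the bound for the letters
  set Mb : ℝ := 1 + ∑ k, ‖b k‖ with hMb
  have hMb1 : 1 ≤ Mb := le_add_of_nonneg_right (Finset.sum_nonneg fun k _ => norm_nonneg _)
  have hMbk : ∀ k, ‖b k‖ ≤ Mb := fun k =>
    (Finset.single_le_sum (f := fun k => ‖b k‖) (fun _ _ => norm_nonneg _) (Finset.mem_univ k)).trans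
      (le_add_of_nonneg_left zero_le_one)
  -- the constants
  obtain ⟨C₅, hC₅0, hC₅⟩ := exists_cellL2In_half_le hL hMb1
  obtain ⟨C₆, hC₆0, hC₆⟩ := exists_annulusL2_constWord_le hL hMb1
  obtain ⟨CD, hCD0, hCD⟩ := exists_neumannData_le L
  obtain ⟨Cg, hCg0, hCg⟩ := exists_cellL2_cylGrad_le_wordSums hL
  set Nt : ℝ := ∑ m ∈ Finset.range 4, ((Fintype.card (Fin m → Fin (Module.finrank ℝ ℝ³)) : ℝ) * 3) with hNt
  have hNt0 : 0 ≤ Nt := Finset.sum_nonneg fun m _ => by positivity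
  set B : ℝ := C₅ + C₆ * CD + (C₅ + C₆) * Cg with hB
  have hB0 : 0 ≤ B := by positivity
  refine ⟨Nt * B, by positivity, fun q G hq hG hqp hGp hN => ?_⟩
  -- the word sums
  set N2 : ℝ := ∑ k ∈ Finset.range 3, ∑ w : Fin k → Fin (Module.finrank ℝ ℝ³),
    cellL2 L (cylWord (jcWord (constWord fun j => b (w j))) (cylLap q)) with hN2
  set N3 : ℝ := ∑ k ∈ Finset.range 4, ∑ w : Fin k → Fin (Module.finrank ℝ ℝ³),
    cellL2 L (cylWord (jcWord (constWord fun j => b (w j))) G) with hN3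
  have hN20 : 0 ≤ N2 := wordSum_nonneg L 2 _
  have hN30 : 0 ≤ N3 := wordSum_nonneg L 3 _
  have hD0 : 0 ≤ neumannData L q G := neumannData_nonneg
  -- the gradient and the data by the word sums
  have hgrad : cellL2 L (cylGrad q) ≤ Cg * (N2 + N3) := hCg q G hq hG hqp hGp hN
  have hdata : neumannData L q G ≤ CD * (N2 + N3) := hCD q G hq hG
  -- one constant word of `q`
  have hone : ∀ (m : ℕ), m < 4 → ∀ (w : Fin m → Fin (Module.finrank ℝ ℝ³)) (i : Fin 3),
      cellL2 L (cylWord (jcWord (constWord fun j => b (w j))) (cylDeriv (fun _ => cylBasis i) q)) ≤ B * (N2 + N3) := by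
    intro m hm w i
    rw [cylWord_constWord_cylDeriv_eq_constFields w (cylBasis i) q]
    set vs : List ℝ³ := (List.ofFn fun j => b (w j)).reverse ++ [cylBasis i] with hvs
    have hlen : vs.length = m + 1 := by simp [hvs]
    have hlet : ∀ v ∈ vs, ‖v‖ ≤ Mb := fun v hv =>
      norm_le_of_mem_basisList w (cylBasis i) hMbk (by rw [norm_cylBasis]; exact hMb1) hv
    have hWc : ContinuousOn (cylWord (constFields vs) q) 𝕂 := (contDiffOn_cylWord_constFields vs hq).continuousOn
    refine (cellL2_le_interior_add_annulus L (1 / 2) hWc).trans ?_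
    have hint : (eLpNorm (cylWord (constFields vs) q) 2
        (volume.restrict ((cylinderCell L : Set ℝ³) ∩ {x | cylRadius x < 1 / 2}))).toReal ≤ C₅ * (N2 + cellL2 L (cylGrad q)) := by
      have h := hC₅ q hq hqp vs (by omega) (by omega) hlet
      rw [← constFields_eq_jcWord] at h
      exact h
    have hann := hC₆ q G hq hG hqp hGp hN vs (by omega) (by omega) hlet
    calc _ ≤ C₅ * (N2 + cellL2 L (cylGrad q)) + C₆ * (neumannData L q G + cellL2 L (cylGrad q)) := add_le_add hint hann
      _ ≤ C₅ * (N2 + Cg * (N2 + N3)) + C₆ * (CD * (N2 + N3) + Cg * (N2 + N3)) := by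
          refine add_le_add (mul_le_mul_of_nonneg_left (by linarith) hC₅0) (mul_le_mul_of_nonneg_left ?_ hC₆0)
          exact add_le_add hdata hgrad
      _ ≤ B * (N2 + N3) := by rw [hB]; nlinarith [mul_nonneg hC₅0 hN30, mul_nonneg hC₆0 hN30]
  -- sum over the words of the gradient
  have hfields : ∀ (m : ℕ) (w : Fin m → Fin (Module.finrank ℝ ℝ³)), ∀ V ∈ jcWord (constWord fun j => b (w j)), ContDiff ℝ ∞ V := by
    intro m w V hV
    obtain ⟨X, -, rfl⟩ := List.mem_map.1 hV
    exact contDiff_jcField X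
  calc (∑ k ∈ Finset.range 4, ∑ w : Fin k → Fin (Module.finrank ℝ ℝ³), cellL2 L (cylWord (jcWord (constWord fun j => b (w j))) (cylGrad q)))
      ≤ ∑ k ∈ Finset.range 4, ∑ w : Fin k → Fin (Module.finrank ℝ ℝ³), ∑ i : Fin 3,
          cellL2 L (cylWord (jcWord (constWord fun j => b (w j))) (cylDeriv (fun _ => cylBasis i) q)) :=
        Finset.sum_le_sum fun m _ => Finset.sum_le_sum fun w _ => cellL2_cylWord_cylGrad_le L _ (hfields m w) hq
    _ ≤ ∑ k ∈ Finset.range 4, ∑ _w : Fin k → Fin (Module.finrank ℝ ℝ³), ∑ _i : Fin 3, B * (N2 + N3) :=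
        Finset.sum_le_sum fun m hm => Finset.sum_le_sum fun w _ => Finset.sum_le_sum fun i _ =>
          hone m (Finset.mem_range.1 hm) w i
    _ = Nt * (B * (N2 + N3)) := by
        simp only [Finset.sum_const, Finset.card_univ, Fintype.card_fin, nsmul_eq_mul, hNt, Finset.sum_mul]
        refine Finset.sum_congr rfl fun m _ => ?_
        push_cast
        ring
    _ = Nt * B * (N2 + N3) := by ring

/-! ### The standard Neumann estimate, in the tree's Sobolev norms -/

/-- **The standard estimate for the Neumann problem on the period cell** (the hypothesis of
`Ferrari1993_periodicCylinderPressureEstimate_of_neumannEstimate`, verbatim): for `L > 0` there is `C`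
such that for all `q`, `G` smooth on the closed cylinder and `L`-periodic with `∂q/∂n = G` on the
wall, `‖∇q‖_{H³(cell)} ≤ C (‖Δq‖_{H²(cell)} + ‖G‖_{H³(cell)})`. [cite: Ferrari1993, proof of Lemma 2,
p. 281 ("the standard estimate"); Temam1975, Lemma 1.2] -/
theorem periodicCylinder_neumannEstimate (L : ℝ) (hL : 0 < L) : ∃ C : ℝ≥0, ∀ (q G : (EuclideanSpace ℝ (Fin 3)) → ℝ),
      ContDiffOn ℝ ∞ q (closure (unitCylinder : Set (EuclideanSpace ℝ (Fin 3)))) →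
      ContDiffOn ℝ ∞ G (closure (unitCylinder : Set (EuclideanSpace ℝ (Fin 3)))) →
      IsAxiallyPeriodic L q → IsAxiallyPeriodic L G →
      (∀ x ∈ frontier (unitCylinder : Set (EuclideanSpace ℝ (Fin 3))),
        fderivWithin ℝ q (closure (unitCylinder : Set (EuclideanSpace ℝ (Fin 3)))) x (eR x) = G x) →
      eSobolevDomainNorm 3 2 (cylinderCell L) volume (gradient q) ≤
        C * (eSobolevDomainNorm 2 2 (cylinderCell L) volume (Δ q) +
          eSobolevDomainNorm 3 2 (cylinderCell L) volume G) := by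
  obtain ⟨C, hC0, hC⟩ := exists_wordSum_cylGrad_le_of_neumann hL
  refine ⟨Real.toNNReal C, fun q G hq hG hqp hGp hN => ?_⟩
  -- the Neumann relation through the radial field
  have hN' : ∀ x ∈ frontier (unitCylinder : Set ℝ³), cylDeriv (fun y => horizontalProj y) q x = G x := by
    intro x hx
    have h := hN x hx
    rw [eR_eq_horizontalProj_of_wall hx] at h
    rw [cylDeriv_apply]
    exact h
  have hreal := hC q G hq hG hqp hGp hN'
  -- the three norms as word sums
  have hgradK : ContDiffOn ℝ ∞ (cylGrad q) 𝕂 := contDiffOn_cylGrad hq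
  have hlapK : ContDiffOn ℝ ∞ (cylLap q) 𝕂 := contDiffOn_cylLap hq
  have e1 : eSobolevDomainNorm 3 2 (cylinderCell L) volume (gradient q) =
      ENNReal.ofReal (∑ k ∈ Finset.range 4, ∑ w : Fin k → Fin (Module.finrank ℝ ℝ³),
        cellL2 L (cylWord (jcWord (constWord fun j => Module.finBasis ℝ ℝ³ (w j))) (cylGrad q))) := by
    rw [eSobolevDomainNorm_gradient_eq_cylGrad L 3 hq, ← toReal_eSobolevDomainNorm_eq_wordSum L 3 hgradK,
      ENNReal.ofReal_toReal (eSobolevDomainNorm_cylinderCell_lt_top L 3 2 hgradK).ne]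
  have e2 : eSobolevDomainNorm 2 2 (cylinderCell L) volume (Δ q) =
      ENNReal.ofReal (∑ k ∈ Finset.range 3, ∑ w : Fin k → Fin (Module.finrank ℝ ℝ³),
        cellL2 L (cylWord (jcWord (constWord fun j => Module.finBasis ℝ ℝ³ (w j))) (cylLap q))) := by
    rw [eSobolevDomainNorm_laplacian_eq_cylLap L 2 hq, ← toReal_eSobolevDomainNorm_eq_wordSum L 2 hlapK,
      ENNReal.ofReal_toReal (eSobolevDomainNorm_cylinderCell_lt_top L 2 2 hlapK).ne]
  have e3 : eSobolevDomainNorm 3 2 (cylinderCell L) volume G =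
      ENNReal.ofReal (∑ k ∈ Finset.range 4, ∑ w : Fin k → Fin (Module.finrank ℝ ℝ³),
        cellL2 L (cylWord (jcWord (constWord fun j => Module.finBasis ℝ ℝ³ (w j))) G)) := by
    rw [← toReal_eSobolevDomainNorm_eq_wordSum L 3 hG,
      ENNReal.ofReal_toReal (eSobolevDomainNorm_cylinderCell_lt_top L 3 2 hG).ne]
  rw [e1, e2, e3, ← ENNReal.ofReal_add (wordSum_nonneg L 2 _) (wordSum_nonneg L 3 _),
    show ((Real.toNNReal C : ℝ≥0) : ℝ≥0∞) = ENNReal.ofReal C from rfl, ← ENNReal.ofReal_mul hC0]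
  exact ENNReal.ofReal_le_ofReal hreal

/-! ### The discharge -/

/-- **Ferrari (1993), Lemma 2, discharged**: the pressure estimate on the periodic cylinder holds.
The reduction `Ferrari1993_periodicCylinderPressureEstimate_of_neumannEstimate` (elliptic Neumann
problem for `p`, product estimates) fed with the standard Neumann estimate on the period cell
`periodicCylinder_neumannEstimate`. [cite: Ferrari1993, Lemma 2, pp. 280–281] -/
theorem Ferrari1993_periodicCylinderPressureEstimate_holds : Ferrari1993_periodicCylinderPressureEstimate :=
  Ferrari1993_periodicCylinderPressureEstimate_of_neumannEstimate periodicCylinder_neumannEstimate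

end Literature.Analysis.FluidPDE
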